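import Mathlib
import HarnessLib
import Summits.ValiantsHypothesis.ValiantsHypothesis.Theorems.LacunarySymmetroidMatrixDescartesOsculationCensusRankOneLower

/-!
# ValiantsHypothesis / LacunarySymmetroid — crux `MatrixDescartes` (stmt-ValiantsHypothesis-18050, V1),
# line «osculation-law» (`Cruxes/MatrixDescartes/Lines/osculation_law.lean`), rung O3: LOWER-SIDE instance — the ν(2,3) row pencil, two-sided `2 ≤ ncard ≤ 18`

Roster R2664 (b) / R2685 (O3 = val-sym-engine-7); critic val-idea-crit-1 VERDICT #76 («the O3 CONTENT is the LOWER side»).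
Companion of `…OsculationCensusExtremisersLower` (ν(2,5): `4 ≤ ncard ≤ 36`).

CONTENT.  `osc_card_nu23_swap`: the ν(2,3) row pencil on `(0,1,3)` (single-digit integer letters `!![4,-7;-7,12]`,
`!![-10,11;11,6]`, `!![9,3;3,1]`) with the projector on the second coordinate — `Finite ∧ 2 ≤ ncard ≤ 18` (located-exact `2`; two
dyadic windows `[1109/2048, 555/1024]`, `[95/128, 191/256]`); the smallest two-sided instance of the table.  Route: `osc_rankOne_card_ge` (`…RankOneLower`) with per-window lemmas (monomial bounds for the sign of
`det G · det G₂₂` on `[l,u]`, exact dyadic evaluations of `R = W(det G)(det G₂₂)² − W(det G₂₂)(det G)²` at the end-points); finiteness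
from `osc_rankOne_finite_card_le` (Bézout + `R(1) ≠ 0` + degrees 6 / 3).  Windows certified by exact rational arithmetic (val-sym-engine-7 g3).

CALIBRATION, NOT LAW.  `m = 2, 3` are covered by `rungTwo` / `rungThree`; the LAW `stub_osculationLaw`, the crux `MatrixDescartes`,
Conjecture B and `VP ≠ VNP` are OPEN / NOT proved; no summit statement is proved by this file.  No definitions, no named facts.
-/

-- `Summit.ValiantsHypothesis.ValiantsHypothesis.…` is the tree's mandated single-conjunct layout (Sub = Summit).
set_option linter.dupNamespace false

noncomputable section

namespace Summit.ValiantsHypothesis.ValiantsHypothesis.Theorems.LacunarySymmetroidMatrixDescartes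

open Polynomial Matrix Finset
open scoped BigOperators

namespace OsculationCensus

/-- Window 0 (nu23s), `[1109/2048, 555/1024]`: branch in the open quadrant (`F·A < 0` by monomial bounds) and a sign
change of the reduced eliminant `R` (exact dyadic evaluations). [folklore] -/
theorem nu23s_window_0 (F A : ℝ[X])
    (hF : F = ((C (12 : ℝ) + C (6 : ℝ) * X + C (1 : ℝ) * X ^ 3) * (C (4 : ℝ) + C ((-10) : ℝ) * X + C (9 : ℝ) * X ^ 3)
      - (C ((-7) : ℝ) + C (11 : ℝ) * X + C (3 : ℝ) * X ^ 3) * (C ((-7) : ℝ) + C (11 : ℝ) * X + C (3 : ℝ) * X ^ 3)))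
    (hA : A = (C (4 : ℝ) + C ((-10) : ℝ) * X + C (9 : ℝ) * X ^ 3)) :
    (0 : ℝ) < 1109/2048 ∧ ((1109/2048 : ℝ) ≤ 555/1024) ∧ (∀ x : ℝ, (1109/2048 : ℝ) ≤ x → x ≤ (555/1024 : ℝ) → F.eval x * A.eval x < 0) ∧
    (((F * (X * derivative (X * derivative F)) - (X * derivative F) ^ 2) * A ^ 2
      - (A * (X * derivative (X * derivative A)) - (X * derivative A) ^ 2) * F ^ 2)).eval (1109/2048 : ℝ) *
    (((F * (X * derivative (X * derivative F)) - (X * derivative F) ^ 2) * A ^ 2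
      - (A * (X * derivative (X * derivative A)) - (X * derivative A) ^ 2) * F ^ 2)).eval (555/1024 : ℝ) ≤ 0 := by
  refine ⟨by norm_num, by norm_num, ?_, ?_⟩
  · intro x hlx hxu
    have hx0 : (0:ℝ) ≤ x := by linarith
    have bl2 := pow_le_pow_left₀ (by norm_num : (0:ℝ) ≤ 1109/2048) hlx 2; have bu2 := pow_le_pow_left₀ hx0 hxu 2; norm_num at bl2 bu2
    have bl3 := pow_le_pow_left₀ (by norm_num : (0:ℝ) ≤ 1109/2048) hlx 3; have bu3 := pow_le_pow_left₀ hx0 hxu 3; norm_num at bl3 bu3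
    have bl4 := pow_le_pow_left₀ (by norm_num : (0:ℝ) ≤ 1109/2048) hlx 4; have bu4 := pow_le_pow_left₀ hx0 hxu 4; norm_num at bl4 bu4
    have eF : F.eval x =
        (((-1) : ℝ) + (58 : ℝ) * x + ((-181) : ℝ) * x ^ 2 + (154 : ℝ) * x ^ 3 + ((-22) : ℝ) * x ^ 4) := by
      rw [hF]; simp only [eval_add, eval_sub, eval_mul, eval_pow, eval_C, eval_X]; ring
    have eA : A.eval x =
        ((4 : ℝ) + ((-10) : ℝ) * x + (9 : ℝ) * x ^ 3) := by
      rw [hA]; simp only [eval_add, eval_mul, eval_pow, eval_C, eval_X]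
    have hFx : F.eval x < 0 := by rw [eF]; linarith
    have hAx : 0 < A.eval x := by rw [eA]; linarith
    exact mul_neg_of_neg_of_pos hFx hAx
  · have rl : (((F * (X * derivative (X * derivative F)) - (X * derivative F) ^ 2) * A ^ 2
      - (A * (X * derivative (X * derivative A)) - (X * derivative A) ^ 2) * F ^ 2)).eval (1109/2048 : ℝ) < 0 := by
      subst hF hA
      simp only [eval_sub, eval_mul, eval_pow, eval_add, eval_C, eval_X,
      derivative_add, derivative_sub, derivative_mul, derivative_C, derivative_X, derivative_X_pow, zero_mul, zero_add,
      one_mul, mul_one]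
      norm_num
    have ru : 0 < (((F * (X * derivative (X * derivative F)) - (X * derivative F) ^ 2) * A ^ 2
      - (A * (X * derivative (X * derivative A)) - (X * derivative A) ^ 2) * F ^ 2)).eval (555/1024 : ℝ) := by
      subst hF hA
      simp only [eval_sub, eval_mul, eval_pow, eval_add, eval_C, eval_X,
      derivative_add, derivative_sub, derivative_mul, derivative_C, derivative_X, derivative_X_pow, zero_mul, zero_add,
      one_mul, mul_one]
      norm_num
    exact le_of_lt (mul_neg_of_neg_of_pos rl ru)

/-- Window 1 (nu23s), `[95/128, 191/256]`: branch in the open quadrant (`F·A < 0` by monomial bounds) and a sign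
change of the reduced eliminant `R` (exact dyadic evaluations). [folklore] -/
theorem nu23s_window_1 (F A : ℝ[X])
    (hF : F = ((C (12 : ℝ) + C (6 : ℝ) * X + C (1 : ℝ) * X ^ 3) * (C (4 : ℝ) + C ((-10) : ℝ) * X + C (9 : ℝ) * X ^ 3)
      - (C ((-7) : ℝ) + C (11 : ℝ) * X + C (3 : ℝ) * X ^ 3) * (C ((-7) : ℝ) + C (11 : ℝ) * X + C (3 : ℝ) * X ^ 3)))
    (hA : A = (C (4 : ℝ) + C ((-10) : ℝ) * X + C (9 : ℝ) * X ^ 3)) :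
    (0 : ℝ) < 95/128 ∧ ((95/128 : ℝ) ≤ 191/256) ∧ (∀ x : ℝ, (95/128 : ℝ) ≤ x → x ≤ (191/256 : ℝ) → F.eval x * A.eval x < 0) ∧
    (((F * (X * derivative (X * derivative F)) - (X * derivative F) ^ 2) * A ^ 2
      - (A * (X * derivative (X * derivative A)) - (X * derivative A) ^ 2) * F ^ 2)).eval (95/128 : ℝ) *
    (((F * (X * derivative (X * derivative F)) - (X * derivative F) ^ 2) * A ^ 2
      - (A * (X * derivative (X * derivative A)) - (X * derivative A) ^ 2) * F ^ 2)).eval (191/256 : ℝ) ≤ 0 := by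
  refine ⟨by norm_num, by norm_num, ?_, ?_⟩
  · intro x hlx hxu
    have hx0 : (0:ℝ) ≤ x := by linarith
    have bl2 := pow_le_pow_left₀ (by norm_num : (0:ℝ) ≤ 95/128) hlx 2; have bu2 := pow_le_pow_left₀ hx0 hxu 2; norm_num at bl2 bu2
    have bl3 := pow_le_pow_left₀ (by norm_num : (0:ℝ) ≤ 95/128) hlx 3; have bu3 := pow_le_pow_left₀ hx0 hxu 3; norm_num at bl3 bu3
    have bl4 := pow_le_pow_left₀ (by norm_num : (0:ℝ) ≤ 95/128) hlx 4; have bu4 := pow_le_pow_left₀ hx0 hxu 4; norm_num at bl4 bu4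
    have eF : F.eval x =
        (((-1) : ℝ) + (58 : ℝ) * x + ((-181) : ℝ) * x ^ 2 + (154 : ℝ) * x ^ 3 + ((-22) : ℝ) * x ^ 4) := by
      rw [hF]; simp only [eval_add, eval_sub, eval_mul, eval_pow, eval_C, eval_X]; ring
    have eA : A.eval x =
        ((4 : ℝ) + ((-10) : ℝ) * x + (9 : ℝ) * x ^ 3) := by
      rw [hA]; simp only [eval_add, eval_mul, eval_pow, eval_C, eval_X]
    have hFx : F.eval x < 0 := by rw [eF]; linarith
    have hAx : 0 < A.eval x := by rw [eA]; linarith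
    exact mul_neg_of_neg_of_pos hFx hAx
  · have rl : 0 < (((F * (X * derivative (X * derivative F)) - (X * derivative F) ^ 2) * A ^ 2
      - (A * (X * derivative (X * derivative A)) - (X * derivative A) ^ 2) * F ^ 2)).eval (95/128 : ℝ) := by
      subst hF hA
      simp only [eval_sub, eval_mul, eval_pow, eval_add, eval_C, eval_X,
      derivative_add, derivative_sub, derivative_mul, derivative_C, derivative_X, derivative_X_pow, zero_mul, zero_add,
      one_mul, mul_one]
      norm_num
    have ru : (((F * (X * derivative (X * derivative F)) - (X * derivative F) ^ 2) * A ^ 2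
      - (A * (X * derivative (X * derivative A)) - (X * derivative A) ^ 2) * F ^ 2)).eval (191/256 : ℝ) < 0 := by
      subst hF hA
      simp only [eval_sub, eval_mul, eval_pow, eval_add, eval_C, eval_X,
      derivative_add, derivative_sub, derivative_mul, derivative_C, derivative_X, derivative_X_pow, zero_mul, zero_add,
      one_mul, mul_one]
      norm_num
    exact le_of_lt (mul_neg_of_pos_of_neg rl ru)

/-- **O3 two-sided instance (ν(2,3) row pencil `(0,1,3)` — letters `!![4,-7;-7,12]`, `!![-10,11;11,6]`, `!![9,3;3,1]` —
with the projector on the SECOND coordinate, i.e. the coordinate-swapped pencil):** the osculation set is finite with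
`2 ≤ ncard ≤ 18`; `2` is the located-exact count (OSC-TABLE-g2 and OSC-TABLE-g3). [folklore] -/
theorem osc_card_nu23_swap (S : Fin 3 → Matrix (Fin 1 ⊕ Fin 1) (Fin 1 ⊕ Fin 1) ℝ)
    (hS : S = ![Matrix.fromBlocks !![(12 : ℝ)] !![-7] !![-7] !![4], Matrix.fromBlocks !![(6 : ℝ)] !![11] !![11] !![-10], Matrix.fromBlocks !![(1 : ℝ)] !![3] !![3] !![9]]) :
    {p : Fin 2 → ℝ | 0 < p 0 ∧ 0 < p 1 ∧ MvPolynomial.eval p (∑ l, (MvPolynomial.X (0 : Fin 2) : MvPolynomial (Fin 2) ℝ) ^ (![0, 1, 3] : Fin 3 → ℕ) l • (S l).map (MvPolynomial.C : ℝ →+*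
      MvPolynomial (Fin 2) ℝ) + (MvPolynomial.X (1 : Fin 2) : MvPolynomial (Fin 2) ℝ) • (Matrix.fromBlocks 1 0 0 0 : Matrix (Fin 1 ⊕ Fin 1) (Fin 1 ⊕ Fin 1) ℝ).map (MvPolynomial.C : ℝ →+*
      MvPolynomial (Fin 2) ℝ)).det = 0 ∧ MvPolynomial.eval p (MvPolynomial.X 0 * MvPolynomial.pderiv 0 (MvPolynomial.X 0 * MvPolynomial.pderiv 0 (∑ l, (MvPolynomial.X (0 : Fin 2) :
      MvPolynomial (Fin 2) ℝ) ^ (![0, 1, 3] : Fin 3 → ℕ) l • (S l).map (MvPolynomial.C : ℝ →+* MvPolynomial (Fin 2) ℝ) + (MvPolynomial.X (1 : Fin 2) : MvPolynomial (Fin 2) ℝ) •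
      (Matrix.fromBlocks 1 0 0 0 : Matrix (Fin 1 ⊕ Fin 1) (Fin 1 ⊕ Fin 1) ℝ).map (MvPolynomial.C : ℝ →+* MvPolynomial (Fin 2) ℝ)).det) * (MvPolynomial.X 1 * MvPolynomial.pderiv 1 (∑ l,
      (MvPolynomial.X (0 : Fin 2) : MvPolynomial (Fin 2) ℝ) ^ (![0, 1, 3] : Fin 3 → ℕ) l • (S l).map (MvPolynomial.C : ℝ →+* MvPolynomial (Fin 2) ℝ) + (MvPolynomial.X (1 : Fin 2) :
      MvPolynomial (Fin 2) ℝ) • (Matrix.fromBlocks 1 0 0 0 : Matrix (Fin 1 ⊕ Fin 1) (Fin 1 ⊕ Fin 1) ℝ).map (MvPolynomial.C : ℝ →+* MvPolynomial (Fin 2) ℝ)).det) ^ 2 - 2 * (MvPolynomial.X 0 *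
      MvPolynomial.pderiv 0 (MvPolynomial.X 1 * MvPolynomial.pderiv 1 (∑ l, (MvPolynomial.X (0 : Fin 2) : MvPolynomial (Fin 2) ℝ) ^ (![0, 1, 3] : Fin 3 → ℕ) l • (S l).map (MvPolynomial.C : ℝ
      →+* MvPolynomial (Fin 2) ℝ) + (MvPolynomial.X (1 : Fin 2) : MvPolynomial (Fin 2) ℝ) • (Matrix.fromBlocks 1 0 0 0 : Matrix (Fin 1 ⊕ Fin 1) (Fin 1 ⊕ Fin 1) ℝ).map (MvPolynomial.C : ℝ →+*
      MvPolynomial (Fin 2) ℝ)).det)) * (MvPolynomial.X 0 * MvPolynomial.pderiv 0 (∑ l, (MvPolynomial.X (0 : Fin 2) : MvPolynomial (Fin 2) ℝ) ^ (![0, 1, 3] : Fin 3 → ℕ) l • (S l).map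
      (MvPolynomial.C : ℝ →+* MvPolynomial (Fin 2) ℝ) + (MvPolynomial.X (1 : Fin 2) : MvPolynomial (Fin 2) ℝ) • (Matrix.fromBlocks 1 0 0 0 : Matrix (Fin 1 ⊕ Fin 1) (Fin 1 ⊕ Fin 1) ℝ).map
      (MvPolynomial.C : ℝ →+* MvPolynomial (Fin 2) ℝ)).det) * (MvPolynomial.X 1 * MvPolynomial.pderiv 1 (∑ l, (MvPolynomial.X (0 : Fin 2) : MvPolynomial (Fin 2) ℝ) ^ (![0, 1, 3] : Fin 3 → ℕ)
      l • (S l).map (MvPolynomial.C : ℝ →+* MvPolynomial (Fin 2) ℝ) + (MvPolynomial.X (1 : Fin 2) : MvPolynomial (Fin 2) ℝ) • (Matrix.fromBlocks 1 0 0 0 : Matrix (Fin 1 ⊕ Fin 1) (Fin 1 ⊕ Fin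
      1) ℝ).map (MvPolynomial.C : ℝ →+* MvPolynomial (Fin 2) ℝ)).det) + MvPolynomial.X 1 * MvPolynomial.pderiv 1 (MvPolynomial.X 1 * MvPolynomial.pderiv 1 (∑ l, (MvPolynomial.X (0 : Fin 2) :
      MvPolynomial (Fin 2) ℝ) ^ (![0, 1, 3] : Fin 3 → ℕ) l • (S l).map (MvPolynomial.C : ℝ →+* MvPolynomial (Fin 2) ℝ) + (MvPolynomial.X (1 : Fin 2) : MvPolynomial (Fin 2) ℝ) •
      (Matrix.fromBlocks 1 0 0 0 : Matrix (Fin 1 ⊕ Fin 1) (Fin 1 ⊕ Fin 1) ℝ).map (MvPolynomial.C : ℝ →+* MvPolynomial (Fin 2) ℝ)).det) * (MvPolynomial.X 0 * MvPolynomial.pderiv 0 (∑ l,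
      (MvPolynomial.X (0 : Fin 2) : MvPolynomial (Fin 2) ℝ) ^ (![0, 1, 3] : Fin 3 → ℕ) l • (S l).map (MvPolynomial.C : ℝ →+* MvPolynomial (Fin 2) ℝ) + (MvPolynomial.X (1 : Fin 2) :
      MvPolynomial (Fin 2) ℝ) • (Matrix.fromBlocks 1 0 0 0 : Matrix (Fin 1 ⊕ Fin 1) (Fin 1 ⊕ Fin 1) ℝ).map (MvPolynomial.C : ℝ →+* MvPolynomial (Fin 2) ℝ)).det) ^ 2) = 0}.Finite ∧
    2 ≤
    {p : Fin 2 → ℝ | 0 < p 0 ∧ 0 < p 1 ∧ MvPolynomial.eval p (∑ l, (MvPolynomial.X (0 : Fin 2) : MvPolynomial (Fin 2) ℝ) ^ (![0, 1, 3] : Fin 3 → ℕ) l • (S l).map (MvPolynomial.C : ℝ →+*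
      MvPolynomial (Fin 2) ℝ) + (MvPolynomial.X (1 : Fin 2) : MvPolynomial (Fin 2) ℝ) • (Matrix.fromBlocks 1 0 0 0 : Matrix (Fin 1 ⊕ Fin 1) (Fin 1 ⊕ Fin 1) ℝ).map (MvPolynomial.C : ℝ →+*
      MvPolynomial (Fin 2) ℝ)).det = 0 ∧ MvPolynomial.eval p (MvPolynomial.X 0 * MvPolynomial.pderiv 0 (MvPolynomial.X 0 * MvPolynomial.pderiv 0 (∑ l, (MvPolynomial.X (0 : Fin 2) :
      MvPolynomial (Fin 2) ℝ) ^ (![0, 1, 3] : Fin 3 → ℕ) l • (S l).map (MvPolynomial.C : ℝ →+* MvPolynomial (Fin 2) ℝ) + (MvPolynomial.X (1 : Fin 2) : MvPolynomial (Fin 2) ℝ) •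
      (Matrix.fromBlocks 1 0 0 0 : Matrix (Fin 1 ⊕ Fin 1) (Fin 1 ⊕ Fin 1) ℝ).map (MvPolynomial.C : ℝ →+* MvPolynomial (Fin 2) ℝ)).det) * (MvPolynomial.X 1 * MvPolynomial.pderiv 1 (∑ l,
      (MvPolynomial.X (0 : Fin 2) : MvPolynomial (Fin 2) ℝ) ^ (![0, 1, 3] : Fin 3 → ℕ) l • (S l).map (MvPolynomial.C : ℝ →+* MvPolynomial (Fin 2) ℝ) + (MvPolynomial.X (1 : Fin 2) :
      MvPolynomial (Fin 2) ℝ) • (Matrix.fromBlocks 1 0 0 0 : Matrix (Fin 1 ⊕ Fin 1) (Fin 1 ⊕ Fin 1) ℝ).map (MvPolynomial.C : ℝ →+* MvPolynomial (Fin 2) ℝ)).det) ^ 2 - 2 * (MvPolynomial.X 0 *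
      MvPolynomial.pderiv 0 (MvPolynomial.X 1 * MvPolynomial.pderiv 1 (∑ l, (MvPolynomial.X (0 : Fin 2) : MvPolynomial (Fin 2) ℝ) ^ (![0, 1, 3] : Fin 3 → ℕ) l • (S l).map (MvPolynomial.C : ℝ
      →+* MvPolynomial (Fin 2) ℝ) + (MvPolynomial.X (1 : Fin 2) : MvPolynomial (Fin 2) ℝ) • (Matrix.fromBlocks 1 0 0 0 : Matrix (Fin 1 ⊕ Fin 1) (Fin 1 ⊕ Fin 1) ℝ).map (MvPolynomial.C : ℝ →+*
      MvPolynomial (Fin 2) ℝ)).det)) * (MvPolynomial.X 0 * MvPolynomial.pderiv 0 (∑ l, (MvPolynomial.X (0 : Fin 2) : MvPolynomial (Fin 2) ℝ) ^ (![0, 1, 3] : Fin 3 → ℕ) l • (S l).map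
      (MvPolynomial.C : ℝ →+* MvPolynomial (Fin 2) ℝ) + (MvPolynomial.X (1 : Fin 2) : MvPolynomial (Fin 2) ℝ) • (Matrix.fromBlocks 1 0 0 0 : Matrix (Fin 1 ⊕ Fin 1) (Fin 1 ⊕ Fin 1) ℝ).map
      (MvPolynomial.C : ℝ →+* MvPolynomial (Fin 2) ℝ)).det) * (MvPolynomial.X 1 * MvPolynomial.pderiv 1 (∑ l, (MvPolynomial.X (0 : Fin 2) : MvPolynomial (Fin 2) ℝ) ^ (![0, 1, 3] : Fin 3 → ℕ)
      l • (S l).map (MvPolynomial.C : ℝ →+* MvPolynomial (Fin 2) ℝ) + (MvPolynomial.X (1 : Fin 2) : MvPolynomial (Fin 2) ℝ) • (Matrix.fromBlocks 1 0 0 0 : Matrix (Fin 1 ⊕ Fin 1) (Fin 1 ⊕ Fin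
      1) ℝ).map (MvPolynomial.C : ℝ →+* MvPolynomial (Fin 2) ℝ)).det) + MvPolynomial.X 1 * MvPolynomial.pderiv 1 (MvPolynomial.X 1 * MvPolynomial.pderiv 1 (∑ l, (MvPolynomial.X (0 : Fin 2) :
      MvPolynomial (Fin 2) ℝ) ^ (![0, 1, 3] : Fin 3 → ℕ) l • (S l).map (MvPolynomial.C : ℝ →+* MvPolynomial (Fin 2) ℝ) + (MvPolynomial.X (1 : Fin 2) : MvPolynomial (Fin 2) ℝ) •
      (Matrix.fromBlocks 1 0 0 0 : Matrix (Fin 1 ⊕ Fin 1) (Fin 1 ⊕ Fin 1) ℝ).map (MvPolynomial.C : ℝ →+* MvPolynomial (Fin 2) ℝ)).det) * (MvPolynomial.X 0 * MvPolynomial.pderiv 0 (∑ l,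
      (MvPolynomial.X (0 : Fin 2) : MvPolynomial (Fin 2) ℝ) ^ (![0, 1, 3] : Fin 3 → ℕ) l • (S l).map (MvPolynomial.C : ℝ →+* MvPolynomial (Fin 2) ℝ) + (MvPolynomial.X (1 : Fin 2) :
      MvPolynomial (Fin 2) ℝ) • (Matrix.fromBlocks 1 0 0 0 : Matrix (Fin 1 ⊕ Fin 1) (Fin 1 ⊕ Fin 1) ℝ).map (MvPolynomial.C : ℝ →+* MvPolynomial (Fin 2) ℝ)).det) ^ 2) = 0}.ncard ∧
    {p : Fin 2 → ℝ | 0 < p 0 ∧ 0 < p 1 ∧ MvPolynomial.eval p (∑ l, (MvPolynomial.X (0 : Fin 2) : MvPolynomial (Fin 2) ℝ) ^ (![0, 1, 3] : Fin 3 → ℕ) l • (S l).map (MvPolynomial.C : ℝ →+*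
      MvPolynomial (Fin 2) ℝ) + (MvPolynomial.X (1 : Fin 2) : MvPolynomial (Fin 2) ℝ) • (Matrix.fromBlocks 1 0 0 0 : Matrix (Fin 1 ⊕ Fin 1) (Fin 1 ⊕ Fin 1) ℝ).map (MvPolynomial.C : ℝ →+*
      MvPolynomial (Fin 2) ℝ)).det = 0 ∧ MvPolynomial.eval p (MvPolynomial.X 0 * MvPolynomial.pderiv 0 (MvPolynomial.X 0 * MvPolynomial.pderiv 0 (∑ l, (MvPolynomial.X (0 : Fin 2) :
      MvPolynomial (Fin 2) ℝ) ^ (![0, 1, 3] : Fin 3 → ℕ) l • (S l).map (MvPolynomial.C : ℝ →+* MvPolynomial (Fin 2) ℝ) + (MvPolynomial.X (1 : Fin 2) : MvPolynomial (Fin 2) ℝ) •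
      (Matrix.fromBlocks 1 0 0 0 : Matrix (Fin 1 ⊕ Fin 1) (Fin 1 ⊕ Fin 1) ℝ).map (MvPolynomial.C : ℝ →+* MvPolynomial (Fin 2) ℝ)).det) * (MvPolynomial.X 1 * MvPolynomial.pderiv 1 (∑ l,
      (MvPolynomial.X (0 : Fin 2) : MvPolynomial (Fin 2) ℝ) ^ (![0, 1, 3] : Fin 3 → ℕ) l • (S l).map (MvPolynomial.C : ℝ →+* MvPolynomial (Fin 2) ℝ) + (MvPolynomial.X (1 : Fin 2) :
      MvPolynomial (Fin 2) ℝ) • (Matrix.fromBlocks 1 0 0 0 : Matrix (Fin 1 ⊕ Fin 1) (Fin 1 ⊕ Fin 1) ℝ).map (MvPolynomial.C : ℝ →+* MvPolynomial (Fin 2) ℝ)).det) ^ 2 - 2 * (MvPolynomial.X 0 *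
      MvPolynomial.pderiv 0 (MvPolynomial.X 1 * MvPolynomial.pderiv 1 (∑ l, (MvPolynomial.X (0 : Fin 2) : MvPolynomial (Fin 2) ℝ) ^ (![0, 1, 3] : Fin 3 → ℕ) l • (S l).map (MvPolynomial.C : ℝ
      →+* MvPolynomial (Fin 2) ℝ) + (MvPolynomial.X (1 : Fin 2) : MvPolynomial (Fin 2) ℝ) • (Matrix.fromBlocks 1 0 0 0 : Matrix (Fin 1 ⊕ Fin 1) (Fin 1 ⊕ Fin 1) ℝ).map (MvPolynomial.C : ℝ →+*
      MvPolynomial (Fin 2) ℝ)).det)) * (MvPolynomial.X 0 * MvPolynomial.pderiv 0 (∑ l, (MvPolynomial.X (0 : Fin 2) : MvPolynomial (Fin 2) ℝ) ^ (![0, 1, 3] : Fin 3 → ℕ) l • (S l).map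
      (MvPolynomial.C : ℝ →+* MvPolynomial (Fin 2) ℝ) + (MvPolynomial.X (1 : Fin 2) : MvPolynomial (Fin 2) ℝ) • (Matrix.fromBlocks 1 0 0 0 : Matrix (Fin 1 ⊕ Fin 1) (Fin 1 ⊕ Fin 1) ℝ).map
      (MvPolynomial.C : ℝ →+* MvPolynomial (Fin 2) ℝ)).det) * (MvPolynomial.X 1 * MvPolynomial.pderiv 1 (∑ l, (MvPolynomial.X (0 : Fin 2) : MvPolynomial (Fin 2) ℝ) ^ (![0, 1, 3] : Fin 3 → ℕ)
      l • (S l).map (MvPolynomial.C : ℝ →+* MvPolynomial (Fin 2) ℝ) + (MvPolynomial.X (1 : Fin 2) : MvPolynomial (Fin 2) ℝ) • (Matrix.fromBlocks 1 0 0 0 : Matrix (Fin 1 ⊕ Fin 1) (Fin 1 ⊕ Fin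
      1) ℝ).map (MvPolynomial.C : ℝ →+* MvPolynomial (Fin 2) ℝ)).det) + MvPolynomial.X 1 * MvPolynomial.pderiv 1 (MvPolynomial.X 1 * MvPolynomial.pderiv 1 (∑ l, (MvPolynomial.X (0 : Fin 2) :
      MvPolynomial (Fin 2) ℝ) ^ (![0, 1, 3] : Fin 3 → ℕ) l • (S l).map (MvPolynomial.C : ℝ →+* MvPolynomial (Fin 2) ℝ) + (MvPolynomial.X (1 : Fin 2) : MvPolynomial (Fin 2) ℝ) •
      (Matrix.fromBlocks 1 0 0 0 : Matrix (Fin 1 ⊕ Fin 1) (Fin 1 ⊕ Fin 1) ℝ).map (MvPolynomial.C : ℝ →+* MvPolynomial (Fin 2) ℝ)).det) * (MvPolynomial.X 0 * MvPolynomial.pderiv 0 (∑ l,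
      (MvPolynomial.X (0 : Fin 2) : MvPolynomial (Fin 2) ℝ) ^ (![0, 1, 3] : Fin 3 → ℕ) l • (S l).map (MvPolynomial.C : ℝ →+* MvPolynomial (Fin 2) ℝ) + (MvPolynomial.X (1 : Fin 2) :
      MvPolynomial (Fin 2) ℝ) • (Matrix.fromBlocks 1 0 0 0 : Matrix (Fin 1 ⊕ Fin 1) (Fin 1 ⊕ Fin 1) ℝ).map (MvPolynomial.C : ℝ →+* MvPolynomial (Fin 2) ℝ)).det) ^ 2) = 0}.ncard ≤ 18 := by
  subst hS
  have hF : (∑ l, (X : ℝ[X]) ^ (![0, 1, 3] : Fin 3 → ℕ) l • ((![Matrix.fromBlocks !![(12 : ℝ)] !![-7] !![-7] !![4], Matrix.fromBlocks !![(6 : ℝ)] !![11] !![11] !![-10], Matrix.fromBlocks !![(1 : ℝ)] !![3] !![3] !![9]] : Fin 3 → Matrix (Fin 1 ⊕ Fin 1) (Fin 1 ⊕ Fin 1) ℝ) l).map Polynomial.C).det =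
      ((C (12 : ℝ) + C (6 : ℝ) * X + C (1 : ℝ) * X ^ 3) * (C (4 : ℝ) + C ((-10) : ℝ) * X + C (9 : ℝ) * X ^ 3)
      - (C ((-7) : ℝ) + C (11 : ℝ) * X + C (3 : ℝ) * X ^ 3) * (C ((-7) : ℝ) + C (11 : ℝ) * X + C (3 : ℝ) * X ^ 3)) := by
    rw [det_pencil_one_one]; simp [Fin.sum_univ_succ, -mul_eq_mul_right_iff, -mul_eq_mul_left_iff]; ring
  have hA : (∑ l, (X : ℝ[X]) ^ (![0, 1, 3] : Fin 3 → ℕ) l • (((![Matrix.fromBlocks !![(12 : ℝ)] !![-7] !![-7] !![4], Matrix.fromBlocks !![(6 : ℝ)] !![11] !![11] !![-10], Matrix.fromBlocks !![(1 : ℝ)] !![3] !![3] !![9]] : Fin 3 → Matrix (Fin 1 ⊕ Fin 1) (Fin 1 ⊕ Fin 1) ℝ) l).toBlocks₂₂).map Polynomial.C).det =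
      (C (4 : ℝ) + C ((-10) : ℝ) * X + C (9 : ℝ) * X ^ 3) := by
    rw [det_lower_one]; simp [Fin.sum_univ_succ, -mul_eq_mul_right_iff, -mul_eq_mul_left_iff]; ring
  obtain ⟨hfin, hle⟩ := osc_rankOne_finite_card_le (![0, 1, 3] : Fin 3 → ℕ) _ _ _ hF hA
    (by
      intro t _ hA0 hF0
      simp only [eval_add, eval_sub, eval_mul, eval_pow, eval_C, eval_X] at hA0 hF0
      have h12 : (((-7) : ℝ) + (11 : ℝ) * t + (3 : ℝ) * t ^ 3) * (((-7) : ℝ) + (11 : ℝ) * t + (3 : ℝ) * t ^ 3) = 0 := by linear_combination ((12 : ℝ) + (6 : ℝ) * t + (1 : ℝ) * t ^ 3) * hA0 - hF0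
      have h12' := mul_self_eq_zero.1 h12
      have hD : (1199 : ℝ) = 0 := by linear_combination (((-12865) : ℝ) + (9675 : ℝ) * t + (16641 : ℝ) * t ^ 2) * h12' + (((-22214) : ℝ) + ((-3225) : ℝ) * t + ((-5547) : ℝ) * t ^ 2) * hA0
      norm_num at hD)
    (by
      intro h
      have h1 := congr_arg (Polynomial.eval (1 : ℝ)) h
      simp only [eval_sub, eval_mul, eval_pow, eval_add, eval_C, eval_X, eval_zero,
        derivative_add, derivative_sub, derivative_mul, derivative_C, derivative_X, derivative_X_pow, zero_mul, zero_add,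
        one_mul, mul_one, one_pow] at h1
      norm_num at h1)
    6 3 (by compute_degree) (by compute_degree)
  refine ⟨hfin, ?_, hle.trans (by norm_num)⟩
  refine osc_rankOne_card_ge (![0, 1, 3] : Fin 3 → ℕ) _ _ _ hF hA hfin [((1109/2048 : ℝ), (555/1024 : ℝ)), ((95/128 : ℝ), (191/256 : ℝ))]
    (by norm_num [List.pairwise_cons]) ?_
  intro w hw
  simp only [List.mem_cons, List.not_mem_nil, or_false] at hw
  rcases hw with rfl | rfl
  · exact nu23s_window_0 _ _ rfl rfl
  · exact nu23s_window_1 _ _ rfl rfl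


end OsculationCensus

end Summit.ValiantsHypothesis.ValiantsHypothesis.Theorems.LacunarySymmetroidMatrixDescartes
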